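import Mathlib.FieldTheory.IsAlgClosed.AlgebraicClosure
import Mathlib.FieldTheory.IntermediateField.Adjoin.Algebra
import Mathlib.NumberTheory.NumberField.Basic
import Literature.AnabelianGeometry.AbsoluteAnabelian.AbsTopIII.KummerFaithfulPadicAbelianProofs
import Literature.AnabelianGeometry.AbsoluteAnabelian.AbsTopIII.KummerFaithfulBaseChangeProofs
import HarnessLib

/-!
# [AbsTopIII] Rmk. 1.5.4 (i) at number fields: every field that embeds in a finite extension of `ℚ_p`
# — in particular every number field — is Kummer-faithful (proof-only companion of `KummerFaithful.lean`)

Mochizuki, *Topics in Absolute Anabelian Geometry III*, §1, Def. 1.5 p. 32 and Rmk. 1.5.4 (i) p. 33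
("every sub-`p`-adic field `k` [...] is Kummer-faithful [...] one reduces immediately, by base-change, to
the case where `k` is a finitely generated extension of an MLF"), manuscript pagination (lit key
`paper:url-5493eb38cbb7`).  Cell abc-iut, FACT-LIST row F-0369 `Rmk_1_5_4_i` (lease abc-iut-f-085),
instance forms at the fields the cone actually uses as GLOBAL base fields: number fields.

Kernel inputs, all PROVED in the tree: the MLF case `isKummerFaithful_of_finite_padic` (abc-iut-f-085,
`KummerFaithfulPadicAbelianProofs`: `A(K)` is a profinite group in the strong topology, via abc-iut-f-070's
`totallyDisconnectedSpace_algPoints`), and descent along field embeddings `IsKummerFaithful.of_ringHom`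
(abc-iut-f-083, `KummerFaithfulBaseChangeProofs`).  New here:

* `exists_finite_extension_of_finite` — the FINITE analogue of `exists_fg_extension_of_finite`
  (`SubpadicFiniteExtension`): if `k` maps into a finite extension `L` of `B` and `F/k` is finite, then
  `F` maps into a finite extension of `B` (the compositum `L(F)` inside an algebraic closure of `L`);
* `isKummerFaithful_of_ringHom_finite_padic` — every field that embeds in a finite extension of `ℚ_p` is
  Kummer-faithful;
* `isKummerFaithful_of_numberField` — every number field is Kummer-faithful (it embeds in a finite
  extension of `ℚ_2`); `Rmk_1_5_4_i_of_numberField` — the named fact `Rmk_1_5_4_i` at number fields.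

HONEST FRAMING: classical; Rmk. 1.5.4 (i) for sub-`p`-adic fields of positive transcendence degree over
`ℚ_p` (e.g. `ℚ_p(t)`) is NOT addressed; no side taken on [IUTchIII] Cor. 3.12; typed ≠ proved; the frozen
statement file is imported, not edited.
-/

noncomputable section

namespace Literature.AnabelianGeometry.AbsoluteAnabelian.AbsTopIII

universe u v

/-! ### Finite extensions of embedded fields embed in finite extensions -/

/-- If `k` maps into a FINITE field extension `L` of `B` and `F ⊇ k` is a finite extension, then `F`
maps into a finite field extension of `B` (namely `L(F)` inside an algebraic closure of `L`) — the
finite analogue of `exists_fg_extension_of_finite` ("by base-change", Rmk. 1.5.4 (i) p. 33: a finite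
extension of a finite extension of `ℚ_p` is a finite extension of `ℚ_p`).
[cite: MochizukiAbsTopIII2015, Rmk 1.5.4 (i) p.33] -/
theorem exists_finite_extension_of_finite {B : Type} [Field B] {k : Type u} [Field k] {F : Type v}
    [Field F] [Algebra k F] [Module.Finite k F]
    (h : ∃ (L : Type) (_ : Field L) (_ : Algebra B L), Module.Finite B L ∧ Nonempty (k →+* L)) :
    ∃ (L' : Type) (_ : Field L') (_ : Algebra B L'), Module.Finite B L' ∧ Nonempty (F →+* L') := by
  obtain ⟨L, _, _, hL, ⟨ι⟩⟩ := h
  haveI := hL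
  -- work inside an algebraic closure `Ω` of `L`
  let Ω : Type := AlgebraicClosure L
  let φ : k →+* Ω := (algebraMap L Ω).comp ι
  letI : Algebra k Ω := φ.toAlgebra
  haveI : Algebra.IsAlgebraic k F := Algebra.IsAlgebraic.of_finite k F
  -- lift the embedding of `k` to `F`
  let ψ : F →ₐ[k] Ω := IsAlgClosed.lift
  -- `L' := L(ψ(F))`, generated over `L` by the images of a `k`-basis of `F`
  classical
  let b := Module.Free.chooseBasis k F
  let s : Finset Ω := (Finset.univ : Finset (Module.Free.ChooseBasisIndex k F)).image
    fun i => ψ (b i)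
  let L' : IntermediateField L Ω := IntermediateField.adjoin L (s : Set Ω)
  have hψ : ∀ x : F, (ψ x : Ω) ∈ L' := by
    intro x
    rw [← b.sum_repr x, map_sum]
    refine sum_mem fun i _ => ?_
    rw [map_smul, Algebra.smul_def]
    refine mul_mem ?_ (IntermediateField.subset_adjoin L _ ?_)
    · -- scalars from `k` land in `L ⊆ L'`: `algebraMap k Ω = (algebraMap L Ω) ∘ ι`
      exact L'.algebraMap_mem (ι (b.repr x i))
    · simp [s]
  -- `L'/L` is finite, hence `L'/B` is finite
  haveI hfin : FiniteDimensional L L' := by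
    refine IntermediateField.finiteDimensional_adjoin (S := (s : Set Ω)) fun x _ => ?_
    exact Algebra.IsIntegral.isIntegral x
  exact ⟨L', inferInstance, inferInstance, Module.Finite.trans L L',
    ⟨(ψ : F →+* Ω).codRestrict L' hψ⟩⟩

/-- A finite extension `F` of a field `k` that embeds in a finite extension `L₀` of `ℚ_p` embeds in a
finite extension of `ℚ_p` (e.g. every number field, over `ℚ ⊆ ℚ_p`).
[cite: MochizukiAbsTopIII2015, Rmk 1.5.4 (i) p.33] -/
theorem exists_ringHom_finite_padic_of_finite (p : ℕ) [Fact p.Prime] {k : Type u} [Field k]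
    {F : Type v} [Field F] [Algebra k F] [Module.Finite k F] {L₀ : Type} [Field L₀]
    [Algebra ℚ_[p] L₀] [Module.Finite ℚ_[p] L₀] (ι : k →+* L₀) :
    ∃ (L : Type) (_ : Field L) (_ : Algebra ℚ_[p] L), Module.Finite ℚ_[p] L ∧ Nonempty (F →+* L) :=
  exists_finite_extension_of_finite (B := ℚ_[p]) ⟨L₀, inferInstance, inferInstance, ‹_›, ⟨ι⟩⟩

/-! ### Kummer-faithfulness of embedded fields and of number fields -/

/-- **Every field that embeds in a finite extension of `ℚ_p` is Kummer-faithful** (tree sense: tori +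
abelian varieties): the finite extension `L₀` is Kummer-faithful (`isKummerFaithful_of_finite_padic`, the
MLF case of Rmk. 1.5.4 (i) p. 33: `A(K)` profinite in the strong topology) and Kummer-faithfulness
descends along field embeddings (`IsKummerFaithful.of_ringHom`, the "by base-change" step of p. 33).
[cite: MochizukiAbsTopIII2015, Rmk 1.5.4 (i) p.33] -/
theorem isKummerFaithful_of_ringHom_finite_padic (p : ℕ) [Fact p.Prime] {k : Type} [Field k]
    {L₀ : Type} [Field L₀] [Algebra ℚ_[p] L₀] [Module.Finite ℚ_[p] L₀] (ι : k →+* L₀) :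
    IsKummerFaithful k :=
  (isKummerFaithful_of_finite_padic p L₀).of_ringHom ι

/-- **Every number field is Kummer-faithful** (in particular `ℚ`): a number field is a finite
extension of `ℚ ⊆ ℚ_2`, hence embeds in a finite extension of `ℚ_2`
(`exists_ringHom_finite_padic_of_finite`), which is Kummer-faithful.  Rmk. 1.5.4 (i) p. 33 at the
global base fields of the cone; the torus half alone is Rmk. 1.5.3 (i) (`Rmk_1_5_3_i_holds`).
[cite: MochizukiAbsTopIII2015, Rmk 1.5.4 (i) p.33] -/
theorem isKummerFaithful_of_numberField (k : Type) [Field k] [NumberField k] : IsKummerFaithful k := by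
  haveI : Fact (Nat.Prime 2) := ⟨Nat.prime_two⟩
  obtain ⟨L, _, _, hL, ⟨j⟩⟩ :=
    exists_ringHom_finite_padic_of_finite 2 (k := ℚ) (F := k) (L₀ := ℚ_[2]) (algebraMap ℚ ℚ_[2])
  haveI := hL
  exact isKummerFaithful_of_ringHom_finite_padic 2 j

/-- **A finite extension of a number field is Kummer-faithful** (it is a number field; stated for an
abstract finite `k'/k` as the cone's interfaces present it). [cite: MochizukiAbsTopIII2015, Rmk 1.5.4 (i) p.33] -/
theorem isKummerFaithful_of_finite_numberField (k : Type) [Field k] [NumberField k] (k' : Type)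
    [Field k'] [Algebra k k'] [Module.Finite k k'] : IsKummerFaithful k' := by
  haveI : Fact (Nat.Prime 2) := ⟨Nat.prime_two⟩
  obtain ⟨L₀, _, _, hL₀, ⟨ι⟩⟩ :=
    exists_ringHom_finite_padic_of_finite 2 (k := ℚ) (F := k) (L₀ := ℚ_[2]) (algebraMap ℚ ℚ_[2])
  haveI := hL₀
  obtain ⟨L, _, _, hL, ⟨j⟩⟩ := exists_ringHom_finite_padic_of_finite 2 (k := k) (F := k') ι
  haveI := hL
  exact isKummerFaithful_of_ringHom_finite_padic 2 j

/-- **The named fact `Rmk_1_5_4_i` ("sub-`p`-adic ⟹ Kummer-faithful") AT NUMBER FIELDS**, which are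
sub-`p`-adic for every `p`: the instance form the cone's global data consume.
[cite: MochizukiAbsTopIII2015, Rmk 1.5.4 (i) p.33] -/
theorem Rmk_1_5_4_i_of_numberField :
    ∀ (k : Type) [Field k] [NumberField k], IsSubpadic k → IsKummerFaithful k :=
  fun k _ _ _ => isKummerFaithful_of_numberField k

/-- **Subfields of finite extensions of `ℚ_p` given as intermediate fields are Kummer-faithful** (e.g.
the algebraic closure of `ℚ` in `K`, or a number field sitting inside its completion).
[cite: MochizukiAbsTopIII2015, Rmk 1.5.4 (i) p.33] -/
theorem isKummerFaithful_intermediateField_finite_padic (p : ℕ) [Fact p.Prime] {k : Type} [Field k]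
    {L₀ : Type} [Field L₀] [Algebra ℚ_[p] L₀] [Module.Finite ℚ_[p] L₀] [Algebra k L₀]
    (E : IntermediateField k L₀) : IsKummerFaithful E :=
  isKummerFaithful_of_ringHom_finite_padic p (algebraMap E L₀)

end Literature.AnabelianGeometry.AbsoluteAnabelian.AbsTopIII
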